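import Summits.QuantumFields.BalabanUV.Beta.GAN24.TwoLevelPairingTransfer
import Summits.QuantumFields.BalabanUV.Beta.GAN24.TwoLevelPairingIdentities
import Summits.QuantumFields.BalabanUV.Beta.GAN24.TwoLevelPairingIdentitiesEnd
import Summits.QuantumFields.BalabanUV.Beta.GAN24.SourcePairingLevelOneGeneric
import Summits.QuantumFields.BalabanUV.Beta.GAN24.SourcePairingSectorsSucc
import Summits.QuantumFields.BalabanUV.Beta.GAN24.PeriodicCubeDefectVanishing
import Summits.QuantumFields.BalabanUV.Beta.GAN24.TowerClassClosure

/-!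
# `BalabanUV.Beta.GAN24.SourcePairingTowerClosed` — binder row G-an2-4 ∕ (CONV-C), the (S) row ∕ (W-γ) one level up, the β-CHAIN (levels ≥ 2), FILE F2c:
# **THE SOURCE PAIRING OF THE RECURSIVE WALL FAMILY IN CLOSED FORM AT EVERY LEVEL, FOR THE TOWER CLASS —
# `X_{j+1}[SrecAt j](h; n, 𝟙_{P-cube y}) = −½·Σ_l Σ'_t h l t·(𝟙(t+e_l)·(C_j n)(l,t)) + ¼·Σ'_Y Σ_κ (C_j h)(κ,Y)·((𝟙 Y + 𝟙(Y+e_κ))·n κ Y)`**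
# at Bałaban's pins `cE = Lc^{d+1}`, `cVH = −½·Lc^{2(d+1)}`, EVERY `cΛ`, EVERY level `j`, EVERY `P ≥ 1`, every `h` (direction-wise summable, bounded) whose multiplier response
# `C_j h` is a `P`-coarse gradient `𝒬ᵀ_P β` (`β κ` summable), every bounded `P`-periodic `n`, every `P`-cube label (`Lc` odd, centred root)
# (G-an2-4 CRUX TEAM (2), seat `b2b-balaban-gan24-formalise-leaf-06` = the (γ) hand, gen 50, journal PROPOSED-3 + A-7 l.51048 (plan F2′))

NOT IN PRINT; OUR BOOKKEEPING ([folklore] BY NAME, an induction on the level `j` over TODAY's chain: base = A-5 `SourcePairingLevelOneGeneric.sourcePairing_levelOne_generic` + F1b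
`PeriodicCubeDefectVanishing` (the `(C2′)_0` defect and the Lagrange sector die); step = F2a `SourcePairingSectorsSucc.slotSum_SrecAt_succ_eq_sectors` (the three sectors of
`SrecAt (j+1)`), `CubicSectorLevelDown.cubicSector_SrecAt_eq_levelDown` (the cubic sector is the level below at the responses) + the induction hypothesis at `P ↦ Lc·P` (F2b
`TowerClassClosure`: the responses are in the class), leaf-02 g61's PART 5 `TwoLevelPairingIdentitiesEnd.pairing_endWeight_fieldResponse_multResponse_eq` ∕ `TwoLevelPairingIdentities.pairing_multResponse_bondSum_eq` ((C1)∕(C2): the main terms one level up with the displayed defects; typed over A-6's β-link),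
F2c′ `TwoLevelPairingTransfer.borderSector_slotSum_eq` (leaf-02 g61's PART 2 slot-summed: the border sector IS `(C1′)_{j+1}`), `LambdaSectorSourcePairingZero.lambdaSector_slotSum_eq_closed`
+ F1b §2 (the Lagrange sector dies), F1b §1 (the `(C2′)_{j+1}` defect dies), and the pin algebra (`wE = stepScale³`, `wVH = stepScale²`, `cH = (stepScale·Lc^{d+1})⁻¹`: the main
coefficients `−½`, `¼` reproduce themselves and the `(C1′)_{j+1}` coefficient vanishes); 0 `def`, 0 cited fact, 0 `def … : Prop`, 0 sorry).
HONEST FRAMING (cell contract, verbatim): «discharging `BetaPertH` makes Bałaban's UV stability UNCONDITIONAL — a real constructive-QFT result; it is NOT the continuum limit and NOT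
the Clay problem.»  HONEST DEPENDENCY (verbatim): «continuum YM on T⁴ ⇐ BetaPertH ∧ nine spine estimates (0/9 proved); BetaPertH ⇐ (D1) ∧ (D4) ∧ CAP+tail; G-an2-4 gates asym,
D1 and NE2/3/4.»

WHY (memo `HOME/b2b-balaban-gan24-formalise-leaf-06/g50/LEVELS-GE2.md`, revised in the journal A-7).  Road-P2 g44∕g45's `hX` hypothesis of
`ExplicitSourceFormLambdaShare.moments_sigmaPair_exit_succ_of_columnPairing` is the closed form of the (γ) source pairing one level up at EVERY level `j`; gen 50's A-4 settled `j = 0`.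
The recursion leaves the two-level class of (δ2b) (the responses of `Lc`-periodic data are `Lc²`-periodic, the label becomes an `Lc²`-cube), but NOT the TOWER CLASS of this file,
which is closed under one level of depth (F2b) and in which every displayed defect vanishes at the level where it is produced (F1b).  The two-level tower datum
`h = colH G_{j+1}(ν, y′)` is in the class with `P = Lc`, `β = (stepScale_{j+1}∕wVH_{j+1})·colM G_{j+1}(ν, y′)` by (E3) (`DataColumnCombRows`) — the consumer file `SourcePairingLevelExplicit`
(road-P2's `hX` at every `j`) instantiates it so.
* §1 `defect_reorder`, `tsum_sum_mul_comm` (termwise reorderings, no analysis); **`sourcePairing_tower_closed`** — the statement in the title, by induction on `j` (all of `P`, `h`, `β`,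
  `n`, `y` generalised).
Asserts NO value of any resolvent column beyond (T1)'s Euler–Lagrange identity, FILE F + (γ) (through (δ1)) and FILE (α); NOTHING of (W-γ)_{≥2}'s remaining rows ∕ (INV) ∕ (Π) ∕
(S) above level 1 discharged beyond this identity; NEVER «G-an2-4 closed» as (CONV-C); NOT D1, NOT `BetaPertH`, NOT continuum, NOT Clay.  2026-08-23; no existing file touched.
-/

noncomputable section

open Finset
open scoped BigOperators
open Literature.MathematicalPhysics.QuantumFieldTheory
open Literature.MathematicalPhysics.QuantumFieldTheory.Balaban1983to89
open Literature.MathematicalPhysics.QuantumFieldTheory.Balaban1983to89.Beta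
open ExpKernelCalculus (Site MKer Decays)
open OneStepResolventKernel (Fib LocStencil)
open AffineAveraging (Form1 box toSite unitVec dz contourSum)
open AffineReproduction (contourSumAdj)
open AveragingContours (blk)
open AveragingContoursRooted (ctrOff ctrOff_mem_box)
open AveragingHessianKernelsRooted (vhSAt hessFFAt)
open InterLevelTransport (SLam)
open KernelSpecInstance (wΦ)
open OneStepKernelFamily (KInvStep colH)
open SecondOrderResponse (colM)
open BalabanStepJetsSucc (E2 lamCoeffK wE wVH wΛ)
open Summit.QuantumFields.BalabanUV.Beta.AxialDressingRooted (coDressKBmAt one_le_of_neZero)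
open Summit.QuantumFields.BalabanUV.Beta.BorderedHessian (stepScale stepScale_ne_zero)
open Summit.QuantumFields.BalabanUV.Beta.SpineRooted (S0NAt e3OfK)
open Summit.QuantumFields.BalabanUV.Beta.WardLocusRecursive (SrecAt SrecAt_zero)
open Summit.QuantumFields.BalabanUV.Beta.GAN24.TransverseDictionary (wΦ_symm)
open Summit.QuantumFields.BalabanUV.Beta.GAN24.CubicPushGaugeLegUnfoldingFF (abs_fieldResponse_le')
open Summit.QuantumFields.BalabanUV.Beta.GAN24.CubicSectorLevelDown (summable_fieldResponse cubicSector_SrecAt_eq_levelDown)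
open Summit.QuantumFields.BalabanUV.Beta.GAN24.LambdaSectorSourcePairingZero (lambdaSector_slotSum_eq_closed)
open Summit.QuantumFields.BalabanUV.Beta.GAN24.SourcePairingLevelOneClosed (slotSum_mul_colM_eq)
open Summit.QuantumFields.BalabanUV.Beta.GAN24.SourcePairingLevelOneGeneric (sourcePairing_levelOne_generic)
open Summit.QuantumFields.BalabanUV.Beta.GAN24.SourcePairingSectorsSucc (slotSum_SrecAt_succ_eq_sectors)
open Summit.QuantumFields.BalabanUV.Beta.GAN24.PeriodicCubeDefectVanishing (periodicCube_defect_eq_zero constraintHessianSector_periodicCube_eq_zero)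
open Summit.QuantumFields.BalabanUV.Beta.GAN24.TowerClassClosure (blk_blk cubeLabel_comp_blk fieldResponse_periodic multResponse_fieldResponse_eq_contourSumAdj_mul)
open Summit.QuantumFields.BalabanUV.Beta.GAN24.TwoLevelPairingTransfer (borderSector_slotSum_eq)
open Summit.QuantumFields.BalabanUV.Beta.GAN24.TwoLevelPairingIdentities (pairing_multResponse_bondSum_eq)
open Summit.QuantumFields.BalabanUV.Beta.GAN24.TwoLevelPairingIdentitiesEnd (pairing_endWeight_fieldResponse_multResponse_eq)

namespace Summit.QuantumFields.BalabanUV.Beta.GAN24.SourcePairingTowerClosed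

variable {d : ℕ}

/-! ## §1 Two termwise reorderings and the level induction -/

/-- [folklore] The displayed `(C2′)` defect of the generic closed form, reordered termwise into (δ2b)'s letters: `Σ'_Y Σ_κ C κ Y·(dzψ κ Y·U κ Y) = Σ'_Y Σ_κ (ψ(Y+e_κ) − ψ Y)·U κ Y·C κ Y`. -/
theorem defect_reorder (ψ : Site (d + 1) → ℝ) (C U : Form1 (d + 1) ℝ) :
    (∑' Y : Site (d + 1), ∑ κ : Fin (d + 1), C κ Y * (dz ψ κ Y * U κ Y))
      = ∑' Y : Site (d + 1), ∑ κ : Fin (d + 1), (ψ (Y + unitVec κ) - ψ Y) * U κ Y * C κ Y :=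
  tsum_congr fun _ => Finset.sum_congr rfl fun _ _ => by simp only [AffineAveraging.dz]; ring

/-- [folklore] `Σ'_Y Σ_μ A μ Y·C μ Y = Σ'_Y Σ_μ C μ Y·A μ Y`. -/
theorem tsum_sum_mul_comm (A C : Form1 (d + 1) ℝ) :
    (∑' Y : Site (d + 1), ∑ μ : Fin (d + 1), A μ Y * C μ Y) = ∑' Y : Site (d + 1), ∑ μ : Fin (d + 1), C μ Y * A μ Y :=
  tsum_congr fun _ => Finset.sum_congr rfl fun _ _ => mul_comm _ _

variable {Lc : ℕ} [NeZero Lc]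

/-- NOT IN PRINT; OUR BOOKKEEPING.  **THE SOURCE PAIRING OF THE RECURSIVE WALL FAMILY IN CLOSED FORM AT EVERY LEVEL, FOR THE TOWER CLASS** (`Lc` odd, centred root
`ρ = toSite (ctrOff (d+1) Lc)`, pins `cE = Lc^{d+1}`, `cVH = −(Lc^{d+1}·½·Lc^{d+1})`, every `cΛ`, every `j`; every `P ≥ 1`; `h` direction-wise summable and bounded with
`C_j h = 𝒬ᵀ_P β` (`hCh`, `β κ` summable); `n` bounded and `P`-periodic; the label `𝟙[blk P · = y]`; `G_j = coDressKBmAt ρ Lc (KInvStep Lc j)`;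
`(C_j n)(l,t) = Σ_κ₀ Σ'_u n κ₀ u·colM G_j Lc κ₀ u l t`, `(C_j h)(κ,Y) = Σ_l Σ'_t h l t·colM G_j Lc l t κ Y`):
`Σ_l Σ'_t h l t·Σ'_{(u,x)} Σ_κκ₂ n κ u·dz𝟙 κ₂ x·e3OfK Lc G_j (SrecAt ρ cE cVH cΛ j) l t u x (inl κ)(inl κ₂) = −½·Σ_l Σ'_t h l t·(𝟙(t+e_l)·(C_j n)(l,t)) + ¼·Σ'_Y Σ_κ (C_j h)(κ,Y)·((𝟙 Y + 𝟙(Y+e_κ))·n κ Y)`. -/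
theorem sourcePairing_tower_closed (hLc : Odd Lc) (cΛ : ℝ) (j : ℕ) :
    ∀ {P : ℕ} [NeZero P] {h : Form1 (d + 1) ℝ} (hh : ∀ l, Summable (h l)) {Bh : ℝ} (hhB : ∀ l t, |h l t| ≤ Bh)
      {β : Form1 (d + 1) ℝ} (hβ : ∀ κ, Summable (β κ))
      (hCh : ∀ (κ : Fin (d + 1)) (Y : Site (d + 1)), (∑ l, ∑' t : Site (d + 1), h l t * colM (coDressKBmAt (toSite (ctrOff (d + 1) Lc)) Lc (KInvStep (d := d) Lc j)) Lc l t κ Y) = contourSumAdj P β κ Y)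
      {n : Form1 (d + 1) ℝ} {Bn : ℝ} (hnB : ∀ l t, |n l t| ≤ Bn) (hper : ∀ (l : Fin (d + 1)) (t z : Site (d + 1)), n l (t + (P : ℤ) • z) = n l t)
      (y : Site (d + 1)),
      ∑ l, ∑' t : Site (d + 1), h l t * ∑' ux : Site (d + 1) × Site (d + 1), ∑ κ, ∑ κ₂, n κ ux.1 * dz (fun x : Site (d + 1) => if blk P x = y then (1 : ℝ) else 0) κ₂ ux.2 *
          e3OfK Lc (coDressKBmAt (toSite (ctrOff (d + 1) Lc)) Lc (KInvStep (d := d) Lc j))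
            (SrecAt d Lc (toSite (ctrOff (d + 1) Lc)) ((Lc : ℝ) ^ (d + 1)) (-((Lc : ℝ) ^ (d + 1) * (1 / 2) * (Lc : ℝ) ^ (d + 1))) cΛ j) l t ux.1 ux.2 (Sum.inl κ) (Sum.inl κ₂)
        = -(1 / 2 : ℝ) * ∑ l, ∑' t : Site (d + 1), h l t * ((if blk P (t + unitVec l) = y then (1 : ℝ) else 0)
            * ∑ κ₀, ∑' u : Site (d + 1), n κ₀ u * colM (coDressKBmAt (toSite (ctrOff (d + 1) Lc)) Lc (KInvStep (d := d) Lc j)) Lc κ₀ u l t)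
          + (1 / 4 : ℝ) * ∑' Y : Site (d + 1), ∑ κ : Fin (d + 1), (∑ l, ∑' t : Site (d + 1), h l t * colM (coDressKBmAt (toSite (ctrOff (d + 1) Lc)) Lc (KInvStep (d := d) Lc j)) Lc l t κ Y)
            * (((if blk P Y = y then (1 : ℝ) else 0) + (if blk P (Y + unitVec κ) = y then (1 : ℝ) else 0)) * n κ Y) := by
  classical
  have hLc1 : 1 ≤ Lc := one_le_of_neZero Lc
  have hr := ctrOff_mem_box (d := d + 1) hLc1
  induction j with
  | zero =>
    intro P _ h hh Bh hhB β hβ hCh n Bn hnB hper y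
    have hφ : ∀ x : Site (d + 1), |(fun x : Site (d + 1) => if blk P x = y then (1 : ℝ) else 0) x| ≤ 1 := fun x => by
      by_cases hx : blk P x = y <;> simp [hx]
    have hn' : ∀ (κ : Fin (d + 1)) (u : Site (d + 1)), |n κ u| ≤ Bn := hnB
    -- the generic level-one closed form, the (C2′)_0 defect and the Lagrange sector
    have hgen := sourcePairing_levelOne_generic (d := d) (Lc := Lc) cΛ hh hnB hφ
    have hD2 := (defect_reorder (d := d) (fun x : Site (d + 1) => if blk P x = y then (1 : ℝ) else 0) _ _).trans
      (periodicCube_defect_eq_zero (d := d) hLc 0 hnB hper y hβ (C := fun κ Y => ∑ l, ∑' t : Site (d + 1), h l t * colM (coDressKBmAt (toSite (ctrOff (d + 1) Lc)) Lc (KInvStep (d := d) Lc 0)) Lc l t κ Y) hCh)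
    have hCw : ∀ (μ : Fin (d + 1)) (w : Site (d + 1)), (∑' t : Site (d + 1), ∑ l, wΦ (N := Lc ^ (0 + 1)) (d := d) l μ (t - w) * h l t) = contourSumAdj P β μ w := by
      intro μ w
      rw [← hCh μ w, slotSum_mul_colM_eq hr 0 hh μ w]
      exact tsum_congr fun t => Finset.sum_congr rfl fun l _ => by rw [wΦ_symm, neg_sub]
    have hΛ := (tsum_sum_mul_comm (d := d) _ _).trans
      (constraintHessianSector_periodicCube_eq_zero (d := d) hLc 0 hnB hper y hβ
        (C := fun μ w => ∑' t : Site (d + 1), ∑ l, wΦ (N := Lc ^ (0 + 1)) (d := d) l μ (t - w) * h l t) hCw)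
    have hΛ' := lambdaSector_slotSum_eq_closed (d := d) (Lc := Lc) 0 hh hhB hn' hφ
    rw [hΛ, mul_zero] at hΛ'
    rw [SrecAt_zero]
    linear_combination hgen + (1 / 4 : ℝ) * hD2 + cΛ * hΛ'
  | succ j ih =>
    intro P _ h hh Bh hhB β hβ hCh n Bn hnB hper y
    have hφ : ∀ x : Site (d + 1), |(fun x : Site (d + 1) => if blk P x = y then (1 : ℝ) else 0) x| ≤ 1 := fun x => by
      by_cases hx : blk P x = y <;> simp [hx]
    have hn' : ∀ (κ : Fin (d + 1)) (u : Site (d + 1)), |n κ u| ≤ Bn := hnB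
    have hhB' : ∀ (κ : Fin (d + 1)) (u : Site (d + 1)), |h κ u| ≤ Bh := hhB
    haveI : NeZero (Lc * P) := ⟨mul_ne_zero (NeZero.ne Lc) (NeZero.ne P)⟩
    have hwVH : wVH d Lc (j + 1) ≠ 0 := by
      unfold BalabanStepJetsSucc.wVH; exact pow_ne_zero _ (pow_ne_zero _ (by exact_mod_cast NeZero.ne Lc))
    have hs0 : stepScale d Lc (j + 1) ≠ 0 := stepScale_ne_zero (j + 1)
    have hL : (Lc : ℝ) ^ (d + 1) ≠ 0 := pow_ne_zero _ (by exact_mod_cast NeZero.ne Lc)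
    -- (1) the data one level down are in the class with `P ↦ Lc·P`
    have hh₁ : ∀ κ', Summable fun u' : Site (d + 1) => ∑ l, ∑' t : Site (d + 1), h l t * colH (coDressKBmAt (toSite (ctrOff (d + 1) Lc)) Lc (KInvStep (d := d) Lc (j + 1))) Lc l t κ' u' :=
      fun κ' => summable_fieldResponse hr (j + 1) hh κ'
    obtain ⟨BH, hBH0, hHb⟩ := abs_fieldResponse_le' (d := d) hr (j + 1) hhB'
    obtain ⟨BN, hBN0, hNb⟩ := abs_fieldResponse_le' (d := d) hr (j + 1) hn'
    have hβ₁ : ∀ κ, Summable fun w : Site (d + 1) => (stepScale d Lc (j + 1) / wVH d Lc (j + 1)) * β κ w := fun κ => (hβ κ).mul_left _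
    have hCh₁ := fun (κ : Fin (d + 1)) (Y : Site (d + 1)) => multResponse_fieldResponse_eq_contourSumAdj_mul (d := d) (Lc := Lc) j hhB' hCh κ Y
    have hper₁ := fun (l : Fin (d + 1)) (t z : Site (d + 1)) => fieldResponse_periodic (d := d) (Lc := Lc) (toSite (ctrOff (d + 1) Lc)) (j + 1) hper l t z
    have hIH := ih (P := Lc * P) hh₁ (fun κ' u' => hHb κ' u') hβ₁ hCh₁ (fun κ'' y' => hNb κ'' y') hper₁ y
    -- (2) the sectors
    rw [slotSum_SrecAt_succ_eq_sectors hr _ _ cΛ j hh hn' hφ, cubicSector_SrecAt_eq_levelDown hr _ _ cΛ j hh hn' hφ,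
      cubeLabel_comp_blk Lc P y, hIH, borderSector_slotSum_eq hr (j + 1) hh hn' hφ,
      lambdaSector_slotSum_eq_closed (d := d) (Lc := Lc) (j + 1) hh hhB hn' hφ]
    -- (3) the main terms one level up, the defects and the Lagrange sector
    have hC1 := pairing_endWeight_fieldResponse_multResponse_eq (d := d) (Lc := Lc) j hh hn' hφ
    have hC2 := pairing_multResponse_bondSum_eq (d := d) (Lc := Lc) j hh hn' hφ
    simp only [blk_blk] at hC1 hC2
    have hD2 := (defect_reorder (d := d) (fun x : Site (d + 1) => if blk P x = y then (1 : ℝ) else 0) _ _).trans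
      (periodicCube_defect_eq_zero (d := d) hLc (j + 1) hnB hper y hβ (C := fun κ Y => ∑ l, ∑' t : Site (d + 1), h l t * colM (coDressKBmAt (toSite (ctrOff (d + 1) Lc)) Lc (KInvStep (d := d) Lc (j + 1))) Lc l t κ Y) hCh)
    have hCw : ∀ (μ : Fin (d + 1)) (w : Site (d + 1)), (∑' t : Site (d + 1), ∑ l, wΦ (N := Lc ^ (j + 1 + 1)) (d := d) l μ (t - w) * h l t) = contourSumAdj P β μ w := by
      intro μ w
      rw [← hCh μ w, slotSum_mul_colM_eq hr (j + 1) hh μ w]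
      exact tsum_congr fun t => Finset.sum_congr rfl fun l _ => by rw [wΦ_symm, neg_sub]
    have hΛ := (tsum_sum_mul_comm (d := d) _ _).trans
      (constraintHessianSector_periodicCube_eq_zero (d := d) hLc (j + 1) hnB hper y hβ
        (C := fun μ w => ∑' t : Site (d + 1), ∑ l, wΦ (N := Lc ^ (j + 1 + 1)) (d := d) l μ (t - w) * h l t) hCw)
    rw [hC1, hC2, hD2, hΛ]
    -- (4) the pin algebra: the main coefficients reproduce themselves, the `(C1′)` coefficient vanishes
    have hq : wE d Lc (j + 1) = (stepScale d Lc (j + 1)) ^ 3 ∧ wVH d Lc (j + 1) = (stepScale d Lc (j + 1)) ^ 2 := by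
      unfold BalabanStepJetsSucc.wE BalabanStepJetsSucc.wVH BorderedHessian.stepScale
      exact ⟨by ring, by ring⟩
    rw [hq.1, hq.2]
    rw [hq.2] at hwVH
    field_simp
    ring

end Summit.QuantumFields.BalabanUV.Beta.GAN24.SourcePairingTowerClosed

end
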